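import Literature.AlgebraicGeometry.Resolution.StableExtensionOfModuli
import Literature.AlgebraicGeometry.Resolution.AlterationsDescent
import Literature.AlgebraicGeometry.Resolution.ComponentsUnderIntegralFlat
import Literature.AlgebraicGeometry.Resolution.SmoothStalksRegular
import HarnessLib

/-!
# De Jong 1996, 4.17 from the finite étale moduli cover of 2.24

Topic: `Literature/AlgebraicGeometry/Resolution`. `StableExtensionOfModuli.lean` proves de Jong's
4.17 (`DeJong1996StableExtension`) from a hypothesis `h224` isolating its moduli input 2.24 in the
family-wise form "there are an INTEGRAL `U'`, a finite surjective generically étale `U' → U` and a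
morphism `U' → M̄` to a projective scheme carrying a pointed semi-stable curve which pulls back to
`(X_U, σ) ×_U U'`". The integrality of `U'` and the generic étaleness of `U' → U` are, however,
not part of 2.24 but the first thing 4.17 DOES with it:

> "This defines a 1-morphism `U → M_{g,n}` of `U` into the algebraic stack classifying smooth
> stable `n`-pointed curves of genus `g`, see 2.24 for notation and results. Choose `ℓ ≥ 3` prime
> to the characteristic of `k`. Let `U' ⊂ U ×_{M_{g,n}} ℓM_{g,n}` be an irreducible component; it
> is finite étale over `U`, nonempty since `ℓ` is prime to the characteristic of `k`."
> (de Jong 1996, 4.17, pp. 71–72)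

while 2.24 itself supplies (p. 62): "`ℓM_{g,n} → M_{g,n}[1/ℓ]` […] the finite étale cover given
by trivializing the `ℓ`-torsion of the Jacobian […] `ℓM_{g,n}` is a scheme […] `ℓM̄_{g,n}` is a
projective scheme over `Spec ℤ[1/ℓ]` […] By pullback from `M̄_{g,n}[1/ℓ]` we get a 'universal'
stable `n`-pointed curve of genus `g` over `ℓM̄_{g,n}`." In scheme-theoretic terms, for the smooth
`n`-pointed family `(X_U → U, σ)`: the base change `S' := U ×_{M_{g,n}} ℓM_{g,n} → U` is a
NONEMPTY FINITE ÉTALE `U`-scheme with a morphism `S' → ℓM_{g,n} ⊆ ℓM̄_{g,n} =: M̄` along which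
the universal pointed curve `(𝒞, τ)` over the projective scheme `M̄` pulls back to
`(X_U, σ) ×_U S'` (the 2-cartesian square defining `S'`).

This file PROVES 4.17 from exactly that (`DeJong1996StableExtension.of_etaleModuliCover`, whose
hypothesis is 2.24 in this form, the isomorphism of the two pulled-back pointed families being
spelled out as in `ModuliOfCurves.ArePullbacksIso`: one pointed family over `S'` cartesian over
both), by supplying de Jong's sentence quoted above:

* `geometricallyReduced_of_etale`, and then Mathlib's
  `GeometricallyReduced.isReduced_of_flat_of_isLocallyNoetherian`: a scheme étale over a reduced
  Noetherian scheme is reduced;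
* `isGenericallyEtale_comp_of_mem_irreducibleComponents`: an irreducible component (reduced
  induced structure) of a reduced Noetherian scheme étale over `U` is generically étale over `U`
  (it is isomorphic to `S'` over the open complement of the other components — the argument of
  `DeJong1996.isGenericallyEtale_comp_fst`, 4.5);
* in the proof of the theorem: the component `U'` through any point of `S' ≠ ∅` is integral
  (`isIntegral_subscheme_vanishingIdeal`), finite over `U`, and SURJECTIVE — flat integral
  morphisms map irreducible components onto irreducible components
  (`image_mem_irreducibleComponents_of_flat_of_isIntegralHom`) and `U` is irreducible; the two
  cartesian squares and the sections restrict along `U' ↪ S'`.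

Then `DeJong1996StableExtension.of_moduli` (the rest of 4.17: the compactification `Y'` of `U'`
over `Y ×_k M̄` and the model `𝒞 ×_{M̄} Y'`) concludes. No definition, no new named fact; 2.24
(Knudsen 1983; Deligne 1985 / Gabber; Pikaart–de Jong 1995 for `ℓM̄_{g,n}`) remains the
hypothesis, now verbatim in the shape the stack-theoretic statement hands to 4.17.

## References

* A. J. de Jong, *Smoothness, semi-stability and alterations*, Publ. Math. IHÉS 83 (1996) 51–93:
  2.24 (p. 62), 4.17 (pp. 71–72), 4.5 (p. 66). [DeJong1996]
* F. Knudsen, *The projectivity of the moduli space of stable curves II, III*, Math. Scand. 52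
  (1983) 161–212. [Knudsen1983]
* P. Deligne, *Le lemme de Gabber*, Astérisque 127 (1985) 131–150. [Deligne1985]
* The Stacks Project, Tag 03HV (generizations lift along flat morphisms), Tag 033B (étale over
  reduced is reduced, via Tag 06LN / 034E).
-/

noncomputable section

open CategoryTheory CategoryTheory.Limits AlgebraicGeometry TopologicalSpace Topology

namespace Literature.AlgebraicGeometry.Resolution

universe u

namespace DeJong1996

open Scheme.IdealSheafData

/-! ## Étale schemes over a reduced base -/

/-- **An étale morphism is geometrically reduced**: its fibres over field points are étale, hence
smooth, over a field, hence reduced (`isReduced_of_smooth`). [cite: StacksProject, Tag 056T with Tag 02GM] -/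
theorem geometricallyReduced_of_etale {S' U : Scheme.{u}} (a : S' ⟶ U) [Etale a] :
    GeometricallyReduced a := by
  refine ⟨fun K _ y Z fst snd sq => ?_⟩
  haveI : Etale snd := MorphismProperty.of_isPullback sq inferInstance
  exact isReduced_of_smooth snd

/-- **A scheme étale over a reduced locally Noetherian scheme is reduced** (Stacks 033B for the
Noetherian case: geometrically reduced fibres and flatness,
`GeometricallyReduced.isReduced_of_flat_of_isLocallyNoetherian`). [cite: StacksProject, Tag 033B] -/
theorem isReduced_of_etale {S' U : Scheme.{u}} (a : S' ⟶ U) [Etale a] [IsReduced U]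
    [IsLocallyNoetherian U] : IsReduced S' :=
  haveI := geometricallyReduced_of_etale a
  GeometricallyReduced.isReduced_of_flat_of_isLocallyNoetherian a

/-! ## An irreducible component of an étale `U`-scheme is generically étale over `U` -/

/-- **An irreducible component of a reduced Noetherian scheme `S'` étale over `U`, with its
reduced (integral) closed-subscheme structure `ι' : C ↪ S'`, is generically étale over `U`**:
over the open complement `W` of the other components the closed immersion `ι'` is surjective onto
the reduced scheme `W`, hence an isomorphism, so `C ⊇ ι'⁻¹(W) ≅ W ⊆ S' → U` is étale on the dense
open `ι'⁻¹(W) ∋ η_C` (the argument of de Jong 1996, 4.5 for `X' ⊆ X ⊗_k k₁`,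
`DeJong1996.isGenericallyEtale_comp_fst`). [cite: DeJong1996, 4.5 p. 66 and 4.17 p. 72 ("it is finite étale over `U`")] -/
theorem isGenericallyEtale_comp_of_mem_irreducibleComponents {C S' U : Scheme.{u}}
    (a : S' ⟶ U) [Etale a] [IsNoetherian S'] [IsReduced S'] [IsIntegral C] (ι' : C ⟶ S')
    [IsClosedImmersion ι'] (hC : Set.range ι' ∈ irreducibleComponents (S' : Type u)) :
    IsGenericallyEtale (ι' ≫ a) := by
  -- the open complement `W` of the other components, contained in `C = range ι'`
  let W : S'.Opens := Scheme.irreducibleComponentOpen S' (Set.range ι')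
  have hWC : (W : Set S') ⊆ Set.range ι' := irreducibleComponentOpen_subset hC
  have hgen : IsGenericPoint (ι' (genericPoint C)) (Set.range ι') := by
    have h := (genericPoint_spec C).image ι'.continuous
    rwa [Set.image_univ, ι'.isClosedEmbedding.isClosed_range.closure_eq] at h
  have hηW : ι' (genericPoint C) ∈ W := mem_irreducibleComponentOpen_of_isGenericPoint hC hgen
  -- `ι'` restricts to an isomorphism over `W`
  haveI : Surjective (ι' ∣_ W) := by
    refine ⟨fun w => ?_⟩
    obtain ⟨x, hx⟩ := hWC w.2
    refine ⟨⟨x, show ι' x ∈ W by rw [hx]; exact w.2⟩, Subtype.ext ?_⟩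
    rw [morphismRestrict_base]
    exact hx
  haveI : IsIso (ι' ∣_ W) := isIso_of_isClosedImmersion_of_surjective _
  refine ⟨ι' ⁻¹ᵁ W, (ι' ⁻¹ᵁ W).isOpen.dense ⟨genericPoint C, hηW⟩, ?_⟩
  rw [← Category.assoc, ← morphismRestrict_ι, Category.assoc]
  infer_instance

end DeJong1996

open DeJong1996 Scheme.IdealSheafData in
/-- **de Jong 1996, 4.17 PROVED from 2.24 in the form the moduli stack hands it over.** The
hypothesis `H` is 2.24 for the smooth `n`-pointed family at hand, family-wise and without
algebraic stacks: for `k` algebraically closed, `U` an integral `k`-scheme of finite type and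
`(p₀ : X₀ → U, σ₀)` smooth proper with geometrically connected fibres all of whose irreducible
components are curves and `n ≥ 3` pairwise disjoint sections (a smooth stable `n`-pointed curve
over `U`, 4.17), there are: a projective `k`-scheme `M̄` ("`ℓM̄_{g,n}` is a projective scheme",
2.24) with a pointed semi-stable curve `(q : 𝒞 → M̄, τ)`, `𝒞` projective over `k` (the
"'universal' stable `n`-pointed curve of genus `g` over `ℓM̄_{g,n}`", 2.24); a NONEMPTY scheme `S'`
with a FINITE ÉTALE `a : S' → U` (`S' = U ×_{M_{g,n}} ℓM_{g,n}`: "`ℓM_{g,n} → M_{g,n}[1/ℓ]` the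
finite étale cover given by trivializing the `ℓ`-torsion of the Jacobian […] is a scheme", 2.24;
"nonempty since `ℓ` is prime to the characteristic of `k`", 4.17) and a `k`-morphism
`u : S' → M̄`; and ONE pointed family `(p' : D → S', ρ)` cartesian over both `(p₀, σ₀)` along `a`
and `(q, τ)` along `u` (the 2-cartesian square: `a*(X₀, σ₀) ≅ u*(𝒞, τ)`, spelled out as in
`ModuliOfCurves.ArePullbacksIso`). CONCLUSION: `DeJong1996StableExtension` (4.17). Proof: de
Jong's "Let `U' ⊂ U ×_{M_{g,n}} ℓM_{g,n}` be an irreducible component; it is finite étale over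
`U`, nonempty" — `S'` is reduced (`isReduced_of_etale`), the component `U'` through a point of
`S'` with its reduced structure is integral, finite over `U`, surjective (flat finite morphisms
map irreducible components onto irreducible components,
`image_mem_irreducibleComponents_of_flat_of_isIntegralHom`, and `U` is irreducible) and
generically étale (`isGenericallyEtale_comp_of_mem_irreducibleComponents`); the cartesian squares
and sections restrict along `U' ↪ S'`; then `DeJong1996StableExtension.of_moduli` (the
compactification `Y' ⊆ N ×_k M̄` and the model `𝒞 ×_{M̄} Y'`).
[cite: DeJong1996, 2.24 p. 62 and 4.17 pp. 71–72] -/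
theorem DeJong1996StableExtension.of_etaleModuliCover
    (H : ∀ (k : Type u) [Field k] [IsAlgClosed k] ⦃U X₀ : Scheme.{u}⦄ [IsIntegral U]
      (gU : U ⟶ Spec (.of k)) [LocallyOfFiniteType gU] [CompactSpace U]
      (p₀ : X₀ ⟶ U) [Smooth p₀] [IsProper p₀] [GeometricallyConnected p₀],
      (∀ (y : U), ∀ C ∈ irreducibleComponents ↥(p₀.fiber y), topologicalKrullDim C = 1) →
      ∀ ⦃n : ℕ⦄, 3 ≤ n → ∀ (σ₀ : Fin n → (U ⟶ X₀)), (∀ i, σ₀ i ≫ p₀ = 𝟙 U) →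
      (Pairwise fun i j => Disjoint (Set.range (σ₀ i)) (Set.range (σ₀ j))) →
      ∃ (M : Scheme.{u}) (gM : M ⟶ Spec (.of k)) (CM : Scheme.{u}) (q : CM ⟶ M)
        (τ : Fin n → (M ⟶ CM)) (S' : Scheme.{u}) (a : S' ⟶ U) (u : S' ⟶ M),
        Motives.IsProjectiveOver (Over.mk gM) ∧ Motives.IsProjectiveOver (Over.mk (q ≫ gM)) ∧
        IsPointedSemiStableCurve q τ ∧ Nonempty S' ∧ IsFinite a ∧ Etale a ∧
        u ≫ gM = a ≫ gU ∧
        ∃ (D : Scheme.{u}) (p' : D ⟶ S') (ρ : Fin n → (S' ⟶ D)) (ψ₁ : D ⟶ X₀) (ψ₂ : D ⟶ CM),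
          (∀ i, ρ i ≫ p' = 𝟙 S') ∧ IsPullback ψ₁ p' p₀ a ∧ (∀ i, ρ i ≫ ψ₁ = a ≫ σ₀ i) ∧
            IsPullback ψ₂ p' q u ∧ (∀ i, ρ i ≫ ψ₂ = u ≫ τ i)) :
    DeJong1996StableExtension.{u} := by
  refine DeJong1996StableExtension.of_moduli ?_
  intro k _ _ U X₀ _ gU _ _ p₀ _ _ _ hdim n hn σ₀ hσ₀ hdisj
  obtain ⟨M, gM, CM, q, τ, S', a, u, hMproj, hCMproj, hq, hne, ha, hae, hu, D, p', ρ, ψ₁, ψ₂,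
    hρ, sq₁, hρ₁, sq₂, hρ₂⟩ := H k gU p₀ hdim hn σ₀ hσ₀ hdisj
  haveI := ha
  haveI := hae
  /- `U` and `S'` are Noetherian; `S'` is reduced -/
  haveI : IsLocallyNoetherian U := isLocallyNoetherian_of_locallyOfFiniteType_field gU
  haveI : IsNoetherian U := ⟨⟩
  haveI : IsLocallyNoetherian S' := LocallyOfFiniteType.isLocallyNoetherian (a ≫ gU)
  haveI : CompactSpace S' := by
    rw [← isCompact_univ_iff, ← Set.preimage_univ (f := a)]
    exact QuasiCompact.isCompact_preimage (f := a) _ isOpen_univ isCompact_univ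
  haveI : IsNoetherian S' := ⟨⟩
  haveI : IsReduced S' := isReduced_of_etale a
  /- the irreducible component `C` through a point of `S'`, with its reduced structure `U'` -/
  obtain ⟨s⟩ := hne
  have hC : irreducibleComponent s ∈ irreducibleComponents (S' : Type u) :=
    irreducibleComponent_mem_irreducibleComponents s
  let Cc : Closeds S' := ⟨irreducibleComponent s, isClosed_irreducibleComponent⟩
  let ι' : ((vanishingIdeal Cc).subscheme : Scheme.{u}) ⟶ S' := (vanishingIdeal Cc).subschemeι
  haveI hint : IsIntegral (vanishingIdeal Cc).subscheme :=
    isIntegral_subscheme_vanishingIdeal Cc isIrreducible_irreducibleComponent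
  have hrange : Set.range ι' = irreducibleComponent s := range_subschemeι_vanishingIdeal Cc
  have hC' : Set.range ι' ∈ irreducibleComponents (S' : Type u) := hrange ▸ hC
  /- `e = U' ↪ S' → U` is finite, surjective and generically étale -/
  haveI : IsFinite (ι' ≫ a) := inferInstance
  have himage : a '' irreducibleComponent s = Set.univ := by
    have h1 : a '' irreducibleComponent s ∈ irreducibleComponents (U : Type u) :=
      image_mem_irreducibleComponents_of_flat_of_isIntegralHom a hC
    rwa [irreducibleComponents_eq_singleton, Set.mem_singleton_iff] at h1
  haveI : Surjective (ι' ≫ a) := by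
    refine ⟨Set.range_eq_univ.mp ?_⟩
    rw [← himage, ← hrange]
    ext y
    constructor
    · rintro ⟨x, rfl⟩
      exact ⟨ι' x, ⟨x, rfl⟩, (Scheme.Hom.comp_apply ι' a x).symm⟩
    · rintro ⟨_, ⟨x, rfl⟩, rfl⟩
      exact ⟨x, Scheme.Hom.comp_apply ι' a x⟩
  have het : IsGenericallyEtale (ι' ≫ a) :=
    isGenericallyEtale_comp_of_mem_irreducibleComponents a ι' hC'
  /- the pointed family restricted to `U'` -/
  have sqa : IsPullback (pullback.fst p' ι' ≫ ψ₁) (pullback.snd p' ι') p₀ (ι' ≫ a) :=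
    (IsPullback.of_hasPullback p' ι').paste_horiz sq₁
  have sqb : IsPullback (pullback.fst p' ι' ≫ ψ₂) (pullback.snd p' ι') q (ι' ≫ u) :=
    (IsPullback.of_hasPullback p' ι').paste_horiz sq₂
  have hw : ∀ i, (ι' ≫ ρ i) ≫ p' = 𝟙 _ ≫ ι' := fun i => by
    rw [Category.assoc, hρ i, Category.comp_id, Category.id_comp]
  let ρ' : Fin n → (((vanishingIdeal Cc).subscheme : Scheme.{u}) ⟶ pullback p' ι') := fun i =>
    pullback.lift (ι' ≫ ρ i) (𝟙 _) (hw i)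
  refine ⟨M, gM, CM, q, τ, (vanishingIdeal Cc).subscheme, hint, ι' ≫ a, ι' ≫ u, pullback p' ι',
    pullback.snd p' ι', pullback.fst p' ι' ≫ ψ₁, pullback.fst p' ι' ≫ ψ₂, ρ', hMproj, hCMproj, hq,
    inferInstance, inferInstance, het, ?_, sqa, sqb, fun i => ⟨?_, ?_, ?_⟩⟩
  · rw [Category.assoc, hu, Category.assoc]
  · exact pullback.lift_snd _ _ _
  · rw [← Category.assoc, pullback.lift_fst, Category.assoc, hρ₁ i, Category.assoc]
  · rw [← Category.assoc, pullback.lift_fst, Category.assoc, hρ₂ i, Category.assoc]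

end Literature.AlgebraicGeometry.Resolution
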